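import Summits.NavierStokesRegularity.FluidComputer.GateBudgetToothClock
import Summits.NavierStokesRegularity.FluidComputer.GateBudgetMemberState
import HarnessLib

/-!
# What no tuning can beat, part 30: THE DUTY CYCLE OF THE COMB AT THE INSTANT — no pump rate
# of the window gives output above 3/4 before √2 + 0.96/K; after √2 + 1/8 every member is a
# tooth or a dud according to |sin wπ| alone

Cell `pub-fluidc`, blueprint seat bp1 (gen 31, eighth item); same namespace and conventions
as parts 1–29 (`GateBudget*.lean`); imports part 27 (`GateBudgetToothClock`: the wait of any
member behind a reversed clock and a small output; through it part 26's Riccati floor behind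
a pin, `knob_member_rate_of_pin`) and part 28 (`GateBudgetMemberState`: the state of EVERY
member of the window at `M = K¹⁰` with Tao's critical window). Modes `0 = a`, `1 = b` clock,
`2 = c` catalyst, `3 = d` transfer, `4 = ã` output; `w = ε/(K¹⁰ρ²)` the winding number,
`σ = |sin wπ|`, `c = |cos wπ|`, `t₋ = √(2 - 24 log K/K¹⁰)`, `t₊ = √(2 + 2/K¹⁰) + 242/K⁹`.
HONEST FRAMING (verbatim): low prior, high value-of-information experiment on Tao's machine
paradigm; NOT a claim that NS blows up.

THE POINT. Part 29 put the two LATTICES of the comb on one clock (half-lattice teeth switch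
inside `[t₋ + 0.96/K, t₊ + 1/K]`, lattice duds stay below `1/10` until `t₋ + 1/8`). This part
covers EVERY pump rate of the window `200ε/K²⁰ ≤ ρ² ≤ 2ε/K¹⁰`, no lattice condition:
§86 (`knob_window_silent`) — NO member has `ã > 3/4` at any `t ≤ t₋ + 24/(25K)` nor
`ã > 19/20` at any `t ≤ t₋ + 9/(5K)` (the wait of part 27 needs only the reversed clock and
`ã(T) ≤ 10⁻³`, which part 28 gives every member): THE EARLIEST SWITCHING TIME OF THE WHOLE
WINDOW IS `√2 + 0.96/K` up to `O(log K/K¹⁰)`; §87 (`knob_member_floor_instant`) — with the pin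
`L = 0.99755σ - 0.07c - 10⁻³ ≤ |d(T)|` of part 28, for EVERY level `0 < m ≤ L² - 10⁻³`:
`ã(t) ≥ √m·tanh(K√m/8)` for all `t ≥ t₊ + 1/8` (part 26's Riccati floor on the self-timed
window, read at its end); §88 (`knob_member_cap_instant`) — with the pin
`L' = 0.99755c - 0.07σ - 10⁻³ ≤ |a(T)|`: `ã(t)² ≤ 1 - L'² + 10⁻³` for all `t ∈ [0, t₋ + 1/8]`
(part 25a's cap). So at the instant `t₊ + 1/8 ≈ √2 + 1/8` the comb's DUTY CYCLE is a function
of `σ = |sin wπ|` alone: a member is certified above `√m·tanh(K√m/8)` as soon as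
`0.99755σ - 0.07c > √(m + 10⁻³)`, and certified below `√(1 - L'² + 10⁻³)` until `t₋ + 1/8` as
soon as `L' ≥ 0` — parts 24b/25b's profile, now on the ABSOLUTE clock and with the Riccati
level in place of the linear one.

HONEST LIMITS. (i) Bolt-on only: part 28's state consumed once per theorem, no new dynamics.
(ii) The floor is read at the END of the self-timed window (`t ≥ t₊ + 1/8`); inside
`[T, T + 1/8]` part 26 gives `√m·tanh(K√m(t - T))` at the member's own `T`, which is not
restated on the absolute clock here (it would need `T`, known only up to `[t₋, t₊]`).
(iii) The level `m` is free; no optimisation, no decimal tanh values typed. (iv) A member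
gets the floor only if `L ≥ √(m + 10⁻³)` for the wanted `m` and the cap only if `L' ≥ 0`;
near `|sin wπ| = |cos wπ|` both pins are weak and the two certificates say little (floor level
small, cap close to `1`) — the transition region of the duty cycle is not resolved further.
(v) Numbers at `M = K¹⁰`, `K ≥ 16` only. (vi) Nothing about Navier–Stokes.
[cite: Tao2016AveragedNS, §5.5 Theorem 5.3, (5.5), (5.6), (b-eq), (c-eq), (tcable)]
-/

noncomputable section

namespace Summit.NavierStokesRegularity.FluidComputer.GateBudget

open Real Set Filter Topology
open Literature.Analysis.FluidPDE.Tao2016AveragedNS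

/-! ## §86 The window is silent before the instant -/

/-- **NO PUMP RATE OF THE WINDOW SWITCHES BEFORE `√2 + 0.96/K`.** For `K ≥ 16`, `0 < ε`,
`ε² ≤ 1/(6K²⁰)` and an exact trajectory of `rotorCircuit K K¹⁰ ε ρ` from (5.6) with
`200ε/K²⁰ ≤ ρ² ≤ 2ε/K¹⁰` (ANY member, no lattice condition): `ã(t) ≤ 3/4` for EVERY
`t ≤ √(2 - 24 log K/K¹⁰) + 24/(25K)` and `ã(t) ≤ 19/20` for every
`t ≤ √(2 - 24 log K/K¹⁰) + 9/(5K)` — part 28's state (`b(T) ≤ -ε/4`, `ã(T) ≤ 10⁻³`,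
`√(2 - 24 log K/K¹⁰) ≤ s₀ < T`), part 27's `knob_tooth_waits_of_clock`, and `ã` monotone
before `T`.
[cite: Tao2016AveragedNS, §5.5 Theorem 5.3, (5.5), (5.6), (b-eq), (c-eq), (tcable)] -/
theorem knob_window_silent {K ε ρ : ℝ} {X : ℝ → Fin 5 → ℝ} {C : ℝ → ℝ}
    (hX : ∀ t, HasDerivAt X (RotorKnob.rotorCircuit K (K ^ 10) ε ρ (X t)) t)
    (h0 : X 0 = delayInit) (hC : ∀ t, HasDerivAt C (X t 2) t) (hK : 16 ≤ K) (hε : 0 < ε)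
    (hεK : ε ^ 2 ≤ 1 / (6 * K ^ 20)) (hρ : 0 < ρ) (hlo : 200 * ε / K ^ 20 ≤ ρ ^ 2)
    (hhi : K ^ 10 * ρ ^ 2 ≤ 2 * ε) :
    (∀ t, t ≤ √(2 - 24 * Real.log K / K ^ 10) + 24 / (25 * K) → X t 4 ≤ 3 / 4) ∧
    (∀ t, t ≤ √(2 - 24 * Real.log K / K ^ 10) + 9 / (5 * K) → X t 4 ≤ 19 / 20) := by
  have hK0 : 0 < K := by linarith
  obtain ⟨s₀, T, hsq1, -, hs1, -, hsT, -, hbT, -, heT, -⟩ :=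
    knob_member_state_headline hX h0 hC hK hε hεK hρ hlo hhi
  have hs0 : 0 ≤ s₀ := by linarith
  have hT0 : 0 ≤ T := by linarith
  have hlow : √(2 - 24 * Real.log K / K ^ 10) ≤ s₀ := (Real.sqrt_le_left hs0).2 hsq1
  obtain ⟨hw1, hw2⟩ := knob_tooth_waits_of_clock hX h0 hK hε hT0 hbT heT
  -- before `T` the output is below `ã(T)` (it never decreases)
  have hmon : Monotone fun t => X t 4 := RotorKnob.rotorCircuit_output_monotone hK0.le hX
  have h24 : (0 : ℝ) < 24 / (25 * K) := by positivity
  have h9 : (0 : ℝ) < 9 / (5 * K) := by positivity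
  refine ⟨fun t ht => ?_, fun t ht => ?_⟩
  · rcases le_total T t with hTt | htT
    · exact hw1 t ⟨hTt, by linarith⟩
    · exact (hmon htT).trans (hw1 T ⟨le_rfl, by linarith⟩)
  · rcases le_total T t with hTt | htT
    · exact hw2 t ⟨hTt, by linarith⟩
    · exact (hmon htT).trans (hw2 T ⟨le_rfl, by linarith⟩)

/-! ## §87 The floor of any member after the instant -/

/-- **THE FLOOR OF ANY MEMBER AFTER `√2 + 1/8`, FROM ITS WINDING NUMBER.** Under the hypotheses
of `knob_window_silent`, write `w = ε/(K¹⁰ρ²)` and `L = (19951/20000)|sin wπ| -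
(7/100)|cos wπ| - 10⁻³` (part 28's lower bracket of `|d(T)|`). If `L ≥ 0`, then for EVERY
level `0 < m ≤ L² - 10⁻³`: `ã(t) ≥ √m·tanh(K·√m/8)` for all `t ≥ √(2 + 2/K¹⁰) + 242/K⁹ + 1/8`
— part 26's `knob_member_rate_of_pin` at `β = ε/4` (window `1/8`, afterglow `A′ ≤ 10⁻³` at
`M = K¹⁰`) behind the pin `L ≤ |d(T)|`, read after the window, and `T ≤ √(2 + 2/K¹⁰) +
242/K⁹`. The half lattice is the case `L = 19931/20000` (part 29); here `σ = |sin wπ|` is free.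
[cite: Tao2016AveragedNS, §5.5 Theorem 5.3, (5.5), (5.6), (b-eq), (c-eq), (tcable)] -/
theorem knob_member_floor_instant {K ε ρ : ℝ} {X : ℝ → Fin 5 → ℝ} {C : ℝ → ℝ}
    (hX : ∀ t, HasDerivAt X (RotorKnob.rotorCircuit K (K ^ 10) ε ρ (X t)) t)
    (h0 : X 0 = delayInit) (hC : ∀ t, HasDerivAt C (X t 2) t) (hK : 16 ≤ K) (hε : 0 < ε)
    (hεK : ε ^ 2 ≤ 1 / (6 * K ^ 20)) (hρ : 0 < ρ) (hlo : 200 * ε / K ^ 20 ≤ ρ ^ 2)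
    (hhi : K ^ 10 * ρ ^ 2 ≤ 2 * ε)
    (hL : 0 ≤ 19951 / 20000 * |sin (ε / (K ^ 10 * ρ ^ 2) * π)|
        - 7 / 100 * |cos (ε / (K ^ 10 * ρ ^ 2) * π)| - 1 / 1000)
    {m : ℝ} (hm0 : 0 < m)
    (hmL : m ≤ (19951 / 20000 * |sin (ε / (K ^ 10 * ρ ^ 2) * π)|
        - 7 / 100 * |cos (ε / (K ^ 10 * ρ ^ 2) * π)| - 1 / 1000) ^ 2 - 1 / 1000) :
    ∀ t, √(2 + 2 / K ^ 10) + 242 / K ^ 9 + 1 / 8 ≤ t → √m * tanh (K * √m * (1 / 8)) ≤ X t 4 := by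
  have hK0 : 0 < K := by linarith
  have hM : 0 < K ^ 10 := by positivity
  obtain ⟨s₀, T, -, hsq2, hs1, -, hsT, hTs, hbT, hcT, -, -, -, -, hd2⟩ :=
    knob_member_state_headline hX h0 hC hK hε hεK hρ hlo hhi
  have hT0 : 0 ≤ T := by linarith
  have hup : s₀ ≤ √(2 + 2 / K ^ 10) := Real.le_sqrt_of_sq_le hsq2
  -- the window `β/(2ε) = 1/8` and the afterglow `A′ ≤ 10⁻³` at `M = K¹⁰`
  have h8 : ε / 4 / (2 * ε) = 1 / 8 := by
    field_simp
    ring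
  have hK10 : (10 : ℝ) ^ 12 ≤ K ^ 10 :=
    le_trans (by norm_num) (pow_le_pow_left₀ (by norm_num) hK 10)
  have hA : 2 * ε * (1 / K ^ 10 + 4 * exp (-K ^ 10) / K ^ 10) / (K ^ 10 * (ε / 4))
      + exp (-K ^ 10) / K ^ 10 ≤ 1 / 1000 := by
    have he1 : exp (-K ^ 10) ≤ 1 := exp_le_one_iff.2 (by linarith)
    have hA' : 2 * ε * (1 / K ^ 10 + 4 * exp (-K ^ 10) / K ^ 10) / (K ^ 10 * (ε / 4))
        + exp (-K ^ 10) / K ^ 10 = (8 * (1 + 4 * exp (-K ^ 10)) / K ^ 10 + exp (-K ^ 10))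
          / K ^ 10 := by
      field_simp
      ring
    have h1 : 8 * (1 + 4 * exp (-K ^ 10)) / K ^ 10 ≤ 40 := by
      rw [div_le_iff₀ hM]
      nlinarith
    rw [hA', div_le_div_iff₀ hM (by norm_num)]
    nlinarith
  -- §78: the Riccati floor behind the pin `L ≤ |d(T)|`, read after the window
  obtain ⟨-, hafter⟩ := knob_member_rate_of_pin hX h0 hε hρ hM hK0.le hT0
    (by positivity : 0 < ε / 4) hbT hcT hL hd2 hm0 (by linarith)
  rw [h8] at hafter
  intro t ht
  exact hafter t (by linarith)

/-! ## §88 The cap of any member until the instant -/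

/-- **THE CAP OF ANY MEMBER UNTIL `√2 + 1/8`, FROM ITS WINDING NUMBER.** Under the hypotheses
of `knob_window_silent`, write `L' = (19951/20000)|cos wπ| - (7/100)|sin wπ| - 10⁻³` (part 28's
lower bracket of `|a(T)|`). If `L' ≥ 0`, then `ã(t)² ≤ 1 - L'² + 10⁻³` for all
`t ∈ [0, √(2 - 24 log K/K¹⁰) + 1/8]` — part 25a's `knob_member_cap_of_pin` on `[0, T + 1/8]`
with the afterglow `headline_afterglow`, and `√(2 - 24 log K/K¹⁰) ≤ s₀ < T`. The lattice is the
case `L' = 19931/20000` (part 29: `ã² ≤ 1/100`); here `c = |cos wπ|` is free.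
[cite: Tao2016AveragedNS, §5.5 Theorem 5.3, (5.5), (5.6), (energy-con), (tcable)] -/
theorem knob_member_cap_instant {K ε ρ : ℝ} {X : ℝ → Fin 5 → ℝ} {C : ℝ → ℝ}
    (hX : ∀ t, HasDerivAt X (RotorKnob.rotorCircuit K (K ^ 10) ε ρ (X t)) t)
    (h0 : X 0 = delayInit) (hC : ∀ t, HasDerivAt C (X t 2) t) (hK : 16 ≤ K) (hε : 0 < ε)
    (hεK : ε ^ 2 ≤ 1 / (6 * K ^ 20)) (hρ : 0 < ρ) (hlo : 200 * ε / K ^ 20 ≤ ρ ^ 2)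
    (hhi : K ^ 10 * ρ ^ 2 ≤ 2 * ε)
    (hL : 0 ≤ 19951 / 20000 * |cos (ε / (K ^ 10 * ρ ^ 2) * π)|
        - 7 / 100 * |sin (ε / (K ^ 10 * ρ ^ 2) * π)| - 1 / 1000) :
    ∀ t ∈ Icc 0 (√(2 - 24 * Real.log K / K ^ 10) + 1 / 8),
      X t 4 ^ 2 ≤ 1 - (19951 / 20000 * |cos (ε / (K ^ 10 * ρ ^ 2) * π)|
        - 7 / 100 * |sin (ε / (K ^ 10 * ρ ^ 2) * π)| - 1 / 1000) ^ 2 + 1 / 1000 := by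
  have hK0 : 0 < K := by linarith
  have hK10 : 0 < K ^ 10 := by positivity
  obtain ⟨s₀, T, hsq1, -, hs1, -, hsT, -, hbT, hcT, -, -, -, ha2, -⟩ :=
    knob_member_state_headline hX h0 hC hK hε hεK hρ hlo hhi
  have hs0 : 0 ≤ s₀ := by linarith
  have hT0 : 0 ≤ T := by linarith
  have hlow : √(2 - 24 * Real.log K / K ^ 10) ≤ s₀ := (Real.sqrt_le_left hs0).2 hsq1
  -- `ρ² ≤ 2ε/K¹⁰ ≤ ε ≤ 1`
  have h10 : (1099511627776 : ℝ) ≤ K ^ 10 := by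
    have := headline_pow_floor hK 10; norm_num at this; exact this
  have hρε : ρ ^ 2 ≤ ε := by
    have := mul_le_mul_of_nonneg_right h10 (sq_nonneg ρ)
    linarith
  have hε1 : ε ≤ 1 := by
    have hK20 : (1700 : ℝ) ≤ K ^ 20 :=
      le_trans (by norm_num) (pow_le_pow_left₀ (by norm_num) hK 20)
    have h1 : ε ^ 2 ≤ 1 := by
      refine hεK.trans ?_
      rw [div_le_one (by positivity)]; linarith
    nlinarith
  -- the self-timed window `β/(2ε) = 1/8` and the afterglow at `β = ε/4`, `M = K¹⁰`
  have h8 : ε / 4 / (2 * ε) = 1 / 8 := by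
    field_simp; ring
  have hA2 : 4 * ε * (1 / K ^ 10 + 4 * exp (-K ^ 10) / K ^ 10 + ε) / (K ^ 10 * (ε / 4))
      = 16 * (1 / K ^ 10 + 4 * exp (-K ^ 10) / K ^ 10 + ε) / K ^ 10 := by
    field_simp; ring
  have hAd := headline_afterglow hK hεK (ε := ε)
  intro t ht
  have ht' : t ∈ Icc 0 (T + ε / 4 / (2 * ε)) := by
    rw [h8]; exact ⟨ht.1, by linarith [ht.2]⟩
  have hcap := knob_member_cap_of_pin hX h0 hε hε1 hρ hρε hK10 hK0.le
    (lam₀ := 1 / K ^ 10 + 4 * exp (-K ^ 10) / K ^ 10) hT0 (by positivity) hbT hcT hL ha2 ht'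
  rw [hA2] at hcap
  linarith

end Summit.NavierStokesRegularity.FluidComputer.GateBudget
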